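import Mathlib
import HarnessLib
import Summits.Ventures.LatticeQCDFlow.Scoring.ChainConfidenceInterval
import Summits.Ventures.LatticeQCDFlow.Scoring.QuantileBand

/-!
# THE EMPIRICAL PROCESS OF A DOEBLIN CHAIN AT A MOVING POINT, from any start: with
# `S_N(t) = (√N)⁻¹ Σ_{i<N} (1{O(X_i) ≤ t} − F_π(t))`, `S_N(t_N) − S_N(q) → 0` in probability whenever
# `t_N → q` and `F_π` is continuous at `q`

HONEST FRAMING: exact (Metropolis-corrected) sampling algorithms for lattice gauge theory;
figures of merit are autocorrelation/cost numbers at stated couplings and volumes; no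
continuum-physics claim.

Venture `LatticeQCDFlow` (cell pub-lqcd), topic `Scoring`; FANOUT row 4 (`s0-u1-b`, rung S0-B).
The chain analogue of row 4's `Scoring/EmpiricalProcessIncrement` (iid, Chebyshev): the step that
turns a central limit theorem for the empirical distribution function of a Markov chain AT the
quantile `q` into the sample-quantile CLT (sequel `Scoring/ChainSampleQuantileCLT`).  For the
simulated chain (Mathlib's `Kernel.trajMeasure`, ANY initial law) of a Markov kernel `κ` with
invariant law `π` and `κ(x, ·) ≥ ε π`, and a measurable real statistic `O` with
`F_π = cdf (π ∘ O⁻¹)` continuous at `q`: **`chain_edfIncrement_tendstoInMeasure`** — along any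
`t_N → q`, `S_N(t_N) − S_N(q) → 0` in probability.  The proof is row 8's any-start Chebyshev bound
`ChainConfidenceInterval.chain_chebyshev_of_doeblin` for the observable
`g_N = 1{O ≤ t_N} − 1{O ≤ q}` (bounded by `1`; the constant `C + |πg_N|` pinned to `2` by the choice
`C = 2 − |πg_N|`), whose stationary variance is at most its second moment
`∫ g_N² dπ = |F_π(t_N) − F_π(q)| → 0` (**`integral_sq_indicator_sub`**,
**`autocov_zero_centred_le`**): `P_{μ₀}(|S_N(t_N) − S_N(q)| ≥ s) ≤ ((2/ε − 1)|F_π(t_N) − F_π(q)| +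
64/(ε²N))/s²`.  No triangular-array CLT is needed.  NEW WORK of the cell; no definition.

## Content

* `integral_indicator_Iic_comp`, `integrable_indicator_Iic_comp`, `sqrt_inv_mul_sum_sub`,
  `integral_sq_indicator_sub`, `autocov_zero_centred_le` — bookkeeping;
* **`chain_edfIncrement_tendstoInMeasure`** — the moving-point step;
* `tendstoInMeasure_add_of_tendsto_zero` — adding a deterministic null sequence.

NOT CLAIMED: a rate uniform in `t`; the oscillation modulus of the chain's empirical process;
any `ε` for a concrete sampler.
-/

noncomputable section

namespace Summit.Ventures.LatticeQCDFlow.Scoring.GlivenkoCantelli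

open MeasureTheory ProbabilityTheory Finset Filter Function
open scoped Topology ENNReal NNReal

variable {Ω : Type*} [MeasurableSpace Ω]

/-! ## §1 Bookkeeping -/

section Bookkeeping

/-- `∫ 1{O ≤ t} dπ = F_π(t)`, `F_π = cdf (π ∘ O⁻¹)`. [folklore] -/
theorem integral_indicator_Iic_comp (π : Measure Ω) [IsProbabilityMeasure π] {O : Ω → ℝ}
    (hO : Measurable O) (t : ℝ) :
    ∫ z, (Set.Iic t).indicator (1 : ℝ → ℝ) (O z) ∂π = cdf (π.map O) t := by
  haveI : IsProbabilityMeasure (π.map O) := Measure.isProbabilityMeasure_map hO.aemeasurable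
  rw [← integral_map hO.aemeasurable
      (measurable_one.indicator measurableSet_Iic).aestronglyMeasurable,
    integral_indicator_one measurableSet_Iic, cdf_eq_real]

/-- `1{O ≤ t}` is measurable, bounded by `1`, integrable. [folklore] -/
theorem integrable_indicator_Iic_comp (π : Measure Ω) [IsProbabilityMeasure π] {O : Ω → ℝ}
    (hO : Measurable O) (t : ℝ) :
    Measurable (fun z => (Set.Iic t).indicator (1 : ℝ → ℝ) (O z))
      ∧ (∀ z, |(Set.Iic t).indicator (1 : ℝ → ℝ) (O z)| ≤ 1)
      ∧ Integrable (fun z => (Set.Iic t).indicator (1 : ℝ → ℝ) (O z)) π := by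
  have hm : Measurable (fun z => (Set.Iic t).indicator (1 : ℝ → ℝ) (O z)) :=
    (measurable_one.indicator measurableSet_Iic).comp hO
  have hb : ∀ z, |(Set.Iic t).indicator (1 : ℝ → ℝ) (O z)| ≤ 1 := fun z => by
    rw [abs_of_nonneg (indicator_one_nonneg _ _)]
    exact indicator_one_le_one _ _
  exact ⟨hm, hb, integrable_of_bounded π hm hb⟩

/-- `(√N)⁻¹ Σ_{i<N} (bᵢ − c) = √N·((Σ_{i<N} bᵢ)/N − c)` for `N ≠ 0`. [folklore] -/
theorem sqrt_inv_mul_sum_sub (b : ℕ → ℝ) (c : ℝ) {N : ℕ} (hN : N ≠ 0) :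
    (Real.sqrt N)⁻¹ * ∑ i ∈ range N, (b i - c)
      = Real.sqrt N * ((∑ i ∈ range N, b i) / N - c) := by
  have hNpos : (0 : ℝ) < N := by exact_mod_cast Nat.pos_of_ne_zero hN
  rw [Finset.sum_sub_distrib, Finset.sum_const, Finset.card_range, nsmul_eq_mul, ← one_div,
    ← Real.sqrt_div_self']
  field_simp

/-- `∫ (1{O ≤ t} − 1{O ≤ q})² dπ = |F_π(t) − F_π(q)|`. [folklore] -/
theorem integral_sq_indicator_sub (π : Measure Ω) [IsProbabilityMeasure π] {O : Ω → ℝ}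
    (hO : Measurable O) (t q : ℝ) :
    ∫ z, ((Set.Iic t).indicator (1 : ℝ → ℝ) (O z) - (Set.Iic q).indicator (1 : ℝ → ℝ) (O z)) ^ 2 ∂π
      = |cdf (π.map O) t - cdf (π.map O) q| := by
  -- the nested case `t ≤ q`, for a general pair
  have key : ∀ t q : ℝ, t ≤ q →
      ∫ z, ((Set.Iic t).indicator (1 : ℝ → ℝ) (O z)
        - (Set.Iic q).indicator (1 : ℝ → ℝ) (O z)) ^ 2 ∂π = cdf (π.map O) q - cdf (π.map O) t := by
    intro t q htq
    have hpt : ∀ z, ((Set.Iic t).indicator (1 : ℝ → ℝ) (O z)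
        - (Set.Iic q).indicator (1 : ℝ → ℝ) (O z)) ^ 2
        = (Set.Iic q).indicator (1 : ℝ → ℝ) (O z) - (Set.Iic t).indicator (1 : ℝ → ℝ) (O z) := by
      intro z
      simp only [Set.indicator_apply, Set.mem_Iic, Pi.one_apply]
      split_ifs with h1 h2 <;> first | (exfalso; linarith) | norm_num
    simp_rw [hpt]
    rw [integral_sub (integrable_indicator_Iic_comp π hO q).2.2
      (integrable_indicator_Iic_comp π hO t).2.2,
      integral_indicator_Iic_comp π hO, integral_indicator_Iic_comp π hO]
  haveI : IsProbabilityMeasure (π.map O) := Measure.isProbabilityMeasure_map hO.aemeasurable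
  rcases le_total t q with htq | hqt
  · rw [key t q htq, abs_of_nonpos (by linarith [monotone_cdf (π.map O) htq])]
    ring
  · have hsymm : ∀ z, ((Set.Iic t).indicator (1 : ℝ → ℝ) (O z)
        - (Set.Iic q).indicator (1 : ℝ → ℝ) (O z)) ^ 2
        = ((Set.Iic q).indicator (1 : ℝ → ℝ) (O z) - (Set.Iic t).indicator (1 : ℝ → ℝ) (O z)) ^ 2 :=
      fun z => by ring
    simp_rw [hsymm]
    rw [key q t hqt, abs_of_nonneg (by linarith [monotone_cdf (π.map O) hqt])]

/-- **The stationary variance is at most the second moment**: for bounded measurable `g`,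
`autocov κ π (g − πg) 0 = Var_π(g) ≤ ∫ g² dπ`. [folklore] -/
theorem autocov_zero_centred_le (κ : Kernel Ω Ω) (π : Measure Ω) [IsProbabilityMeasure π]
    {g : Ω → ℝ} (hg : Measurable g) {C : ℝ} (hC : ∀ x, |g x| ≤ C) :
    autocov κ π (fun y => g y - ∫ z, g z ∂π) 0 ≤ ∫ y, g y ^ 2 ∂π := by
  set m : ℝ := ∫ z, g z ∂π with hm
  have hgi : Integrable g π := integrable_of_bounded π hg hC
  have hg2 : Integrable (fun y => g y ^ 2) π := by
    refine integrable_of_bounded π (hg.pow_const 2) (C := C ^ 2) fun y => ?_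
    rw [abs_pow]
    exact pow_le_pow_left₀ (abs_nonneg _) (hC y) 2
  rw [autocov_zero]
  have B : Integrable (fun y => 2 * m * g y - m ^ 2) π :=
    (hgi.const_mul (2 * m)).sub (integrable_const _)
  have h1 : ∫ y, (g y - m) ^ 2 ∂π = ∫ y, g y ^ 2 ∂π - ∫ y, (2 * m * g y - m ^ 2) ∂π := by
    rw [← integral_sub hg2 B]
    exact integral_congr_ae (ae_of_all _ fun y => by ring)
  have h2 : ∫ y, (2 * m * g y - m ^ 2) ∂π = m ^ 2 := by
    rw [integral_sub (hgi.const_mul (2 * m)) (integrable_const _), integral_const_mul,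
      integral_const, probReal_univ, one_smul, ← hm]
    ring
  rw [h1, h2]
  nlinarith [sq_nonneg m]

end Bookkeeping

/-! ## §2 The moving-point step along a Doeblin chain -/

section Increment

variable {κ : Kernel Ω Ω} [IsMarkovKernel κ] {μ₀ : Measure Ω} [IsProbabilityMeasure μ₀]
  {π : Measure Ω} [IsProbabilityMeasure π]

/-- **THE EMPIRICAL PROCESS OF A DOEBLIN CHAIN AT A MOVING POINT, FROM ANY START.**  `π` invariant
for `κ`, `κ(x, ·) ≥ ε π` (`ε > 0`), `O` measurable, `F_π` continuous at `q`, `t_N → q`.  Then with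
`S_N(t) = (√N)⁻¹ Σ_{i<N} (1{O(X_i) ≤ t} − F_π(t))`, `S_N(t_N) − S_N(q) → 0` in probability under
the trajectory law from any initial law. [ours] (Chebyshev from any start for the observable
`1{O ≤ t_N} − 1{O ≤ q}`, whose stationary variance is `≤ |F_π(t_N) − F_π(q)|`) -/
theorem chain_edfIncrement_tendstoInMeasure (hπ : Kernel.Invariant κ π) {ε : ℝ≥0∞}
    (hmin : ∀ x {B : Set Ω}, MeasurableSet B → ε * π B ≤ κ x B) (hε0 : 0 < ε)
    {O : Ω → ℝ} (hO : Measurable O) {q : ℝ} (hcont : ContinuousAt (cdf (π.map O)) q)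
    {t : ℕ → ℝ} (ht : Tendsto t atTop (𝓝 q)) :
    TendstoInMeasure (Kernel.trajMeasure (X := fun _ : ℕ => Ω) μ₀
          (fun m : ℕ => κ.comap (fun y : (i : ↥(Finset.Iic m)) → Ω => y ⟨m, Finset.mem_Iic.2 le_rfl⟩)
            (measurable_pi_apply _)))
      (fun (N : ℕ) (ξ : ℕ → Ω) =>
        (Real.sqrt N)⁻¹ * ∑ i ∈ range N,
            ((Set.Iic (t N)).indicator (1 : ℝ → ℝ) (O (ξ i)) - cdf (π.map O) (t N))
          - (Real.sqrt N)⁻¹ * ∑ i ∈ range N,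
            ((Set.Iic q).indicator (1 : ℝ → ℝ) (O (ξ i)) - cdf (π.map O) q))
      atTop (fun _ => 0) := by
  set P := Kernel.trajMeasure (X := fun _ : ℕ => Ω) μ₀
      (fun m : ℕ => κ.comap (fun y : (i : ↥(Finset.Iic m)) → Ω => y ⟨m, Finset.mem_Iic.2 le_rfl⟩)
        (measurable_pi_apply _)) with hP
  haveI : IsProbabilityMeasure (π.map O) := Measure.isProbabilityMeasure_map hO.aemeasurable
  obtain ⟨-, -, -, -, -, he⟩ := half_const_bounds hmin hε0
  have hε1 : ε ≤ 1 := eps_le_one_of_doeblin hmin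
  set e : ℝ := ε.toReal with hedef
  have he1 : e ≤ 1 := by
    rw [hedef, ← ENNReal.toReal_one]
    exact (ENNReal.toReal_le_toReal (ne_top_of_le_ne_top ENNReal.one_ne_top hε1)
      ENNReal.one_ne_top).2 hε1
  have hcoef : 0 ≤ 2 / e - 1 := by
    rw [sub_nonneg, le_div_iff₀ he]
    linarith
  -- the difference observable and its stationary mean and variance
  set F := cdf (π.map O) with hF
  have hgm : ∀ N, Measurable fun z => (Set.Iic (t N)).indicator (1 : ℝ → ℝ) (O z)
      - (Set.Iic q).indicator (1 : ℝ → ℝ) (O z) := fun N =>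
    ((measurable_one.indicator measurableSet_Iic).comp hO).sub
      ((measurable_one.indicator measurableSet_Iic).comp hO)
  have hgb : ∀ N z, |(Set.Iic (t N)).indicator (1 : ℝ → ℝ) (O z)
      - (Set.Iic q).indicator (1 : ℝ → ℝ) (O z)| ≤ 1 := fun N z => by
    rw [abs_le]
    constructor <;> linarith [indicator_one_nonneg (Set.Iic (t N)) (O z),
      indicator_one_le_one (Set.Iic (t N)) (O z), indicator_one_nonneg (Set.Iic q) (O z),
      indicator_one_le_one (Set.Iic q) (O z)]
  have hmean : ∀ N, ∫ z, ((Set.Iic (t N)).indicator (1 : ℝ → ℝ) (O z)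
      - (Set.Iic q).indicator (1 : ℝ → ℝ) (O z)) ∂π = F (t N) - F q := fun N => by
    rw [integral_sub (integrable_indicator_Iic_comp π hO (t N)).2.2
      (integrable_indicator_Iic_comp π hO q).2.2,
      integral_indicator_Iic_comp π hO, integral_indicator_Iic_comp π hO]
  have hmb : ∀ N, |F (t N) - F q| ≤ 1 := fun N => by
    rw [abs_le]
    constructor <;> linarith [cdf_nonneg (π.map O) (t N), cdf_le_one (π.map O) (t N),
      cdf_nonneg (π.map O) q, cdf_le_one (π.map O) q]
  -- `|g| ≤ C := 2 − |πg|`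
  have hC : ∀ N z, |(Set.Iic (t N)).indicator (1 : ℝ → ℝ) (O z)
      - (Set.Iic q).indicator (1 : ℝ → ℝ) (O z)|
      ≤ 2 - |∫ z, ((Set.Iic (t N)).indicator (1 : ℝ → ℝ) (O z)
        - (Set.Iic q).indicator (1 : ℝ → ℝ) (O z)) ∂π| := fun N z => by
    rw [hmean]
    linarith [hgb N z, hmb N]
  -- the variance bound
  have hvar : ∀ N, autocov κ π (fun y => ((Set.Iic (t N)).indicator (1 : ℝ → ℝ) (O y)
      - (Set.Iic q).indicator (1 : ℝ → ℝ) (O y)) - ∫ z, ((Set.Iic (t N)).indicator (1 : ℝ → ℝ) (O z)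
        - (Set.Iic q).indicator (1 : ℝ → ℝ) (O z)) ∂π) 0 ≤ |F (t N) - F q| := fun N => by
    refine (autocov_zero_centred_le κ π (hgm N) (hgb N)).trans (le_of_eq ?_)
    exact integral_sq_indicator_sub π hO (t N) q
  have hFt : Tendsto (fun N => |F (t N) - F q|) atTop (𝓝 0) := by
    have h1 : Tendsto (fun N => F (t N)) atTop (𝓝 (F q)) := hcont.tendsto.comp ht
    have h2 := (h1.sub_const (F q)).abs
    simpa using h2
  rw [tendstoInMeasure_iff_norm]
  intro s hs
  -- the Chebyshev bound, for `N ≥ 1`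
  have hbound : ∀ᶠ N : ℕ in atTop,
      P.real {ξ | s ≤ ‖(Real.sqrt N)⁻¹ * ∑ i ∈ range N,
            ((Set.Iic (t N)).indicator (1 : ℝ → ℝ) (O (ξ i)) - F (t N))
          - (Real.sqrt N)⁻¹ * ∑ i ∈ range N,
            ((Set.Iic q).indicator (1 : ℝ → ℝ) (O (ξ i)) - F q) - 0‖}
        ≤ ((2 / e - 1) * |F (t N) - F q| + 64 / (e ^ 2 * N)) / s ^ 2 := by
    filter_upwards [eventually_ge_atTop 1] with N hN1
    have hN : N ≠ 0 := by omega
    have hNpos : (0 : ℝ) < N := by exact_mod_cast hN1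
    have hsq : 0 < Real.sqrt N := Real.sqrt_pos.2 hNpos
    have hs' : 0 < s / Real.sqrt N := div_pos hs hsq
    have hcheb := chain_chebyshev_of_doeblin (μ₀ := μ₀) hπ hmin hε0 (hgm N) (hC N) hN hs'
    beta_reduce at hcheb
    rw [← hP, ← hedef, hmean, sub_add_cancel] at hcheb
    -- the event: `|D_N| ≥ s ↔ |A_N(g) − πg| ≥ s/√N`
    have hsub : {ξ : ℕ → Ω | s ≤ ‖(Real.sqrt N)⁻¹ * ∑ i ∈ range N,
            ((Set.Iic (t N)).indicator (1 : ℝ → ℝ) (O (ξ i)) - F (t N))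
          - (Real.sqrt N)⁻¹ * ∑ i ∈ range N,
            ((Set.Iic q).indicator (1 : ℝ → ℝ) (O (ξ i)) - F q) - 0‖}
        ⊆ {ξ | s / Real.sqrt N ≤ |(∑ i ∈ range N, ((Set.Iic (t N)).indicator (1 : ℝ → ℝ) (O (ξ i))
            - (Set.Iic q).indicator (1 : ℝ → ℝ) (O (ξ i)))) / N - (F (t N) - F q)|} := by
      intro ξ hξ
      simp only [Set.mem_setOf_eq, sub_zero, Real.norm_eq_abs] at hξ ⊢
      have hre : (Real.sqrt N)⁻¹ * ∑ i ∈ range N,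
            ((Set.Iic (t N)).indicator (1 : ℝ → ℝ) (O (ξ i)) - F (t N))
          - (Real.sqrt N)⁻¹ * ∑ i ∈ range N,
            ((Set.Iic q).indicator (1 : ℝ → ℝ) (O (ξ i)) - F q)
          = Real.sqrt N * ((∑ i ∈ range N, ((Set.Iic (t N)).indicator (1 : ℝ → ℝ) (O (ξ i))
            - (Set.Iic q).indicator (1 : ℝ → ℝ) (O (ξ i)))) / N - (F (t N) - F q)) := by
        rw [← sqrt_inv_mul_sum_sub _ _ hN, ← mul_sub, ← Finset.sum_sub_distrib]
        congr 1
        refine Finset.sum_congr rfl fun i _ => ?_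
        ring
      rw [hre, abs_mul, abs_of_pos hsq] at hξ
      rw [div_le_iff₀ hsq, mul_comm]
      exact hξ
    refine (measureReal_mono hsub (measure_ne_top P _)).trans (hcheb.trans ?_)
    -- simplify the Chebyshev bound
    have hden : (s / Real.sqrt N) ^ 2 = s ^ 2 / N := by
      rw [div_pow, Real.sq_sqrt hNpos.le]
    rw [hden, div_div_eq_mul_div]
    refine div_le_div_of_nonneg_right ?_ (by positivity)
    have hV := hvar N
    have e1 : ((2 / e - 1) * autocov κ π (fun y => ((Set.Iic (t N)).indicator (1 : ℝ → ℝ) (O y)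
        - (Set.Iic q).indicator (1 : ℝ → ℝ) (O y)) - (F (t N) - F q)) 0 / N
        + 16 * 2 ^ 2 / (e ^ 2 * (N : ℝ) ^ 2)) * N
        = (2 / e - 1) * autocov κ π (fun y => ((Set.Iic (t N)).indicator (1 : ℝ → ℝ) (O y)
          - (Set.Iic q).indicator (1 : ℝ → ℝ) (O y)) - (F (t N) - F q)) 0 + 64 / (e ^ 2 * N) := by
      field_simp
      ring
    rw [hmean] at hV
    rw [e1]
    have := mul_le_mul_of_nonneg_left hV hcoef
    linarith
  -- the bound tends to zero
  have hlim : Tendsto (fun N : ℕ => ((2 / e - 1) * |F (t N) - F q| + 64 / (e ^ 2 * N)) / s ^ 2)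
      atTop (𝓝 0) := by
    have h1 : Tendsto (fun N : ℕ => (2 / e - 1) * |F (t N) - F q|) atTop (𝓝 0) := by
      simpa using hFt.const_mul (2 / e - 1)
    have h2 : Tendsto (fun N : ℕ => (64 : ℝ) / (e ^ 2 * N)) atTop (𝓝 0) := by
      have h3 : Tendsto (fun N : ℕ => e ^ 2 * (N : ℝ)) atTop atTop :=
        tendsto_natCast_atTop_atTop.const_mul_atTop (by positivity)
      exact h3.const_div_atTop 64
    simpa using (h1.add h2).div_const (s ^ 2)
  have hreal := squeeze_zero' (Eventually.of_forall fun n => measureReal_nonneg) hbound hlim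
  have := ENNReal.tendsto_ofReal hreal
  rw [ENNReal.ofReal_zero] at this
  refine this.congr' (Eventually.of_forall fun n => ?_)
  exact ofReal_measureReal (measure_ne_top _ _)

/-- Adding a deterministic null sequence preserves convergence in probability to `0` (real
statistics). [folklore] -/
theorem tendstoInMeasure_add_of_tendsto_zero {P : Measure (ℕ → Ω)} {D : ℕ → (ℕ → Ω) → ℝ}
    (hD : TendstoInMeasure P D atTop (fun _ => 0)) {d : ℕ → ℝ} (hd : Tendsto d atTop (𝓝 0)) :
    TendstoInMeasure P (fun N ξ => D N ξ + d N) atTop (fun _ => 0) := by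
  rw [tendstoInMeasure_iff_norm] at hD ⊢
  intro s hs
  have hd' : ∀ᶠ N in atTop, |d N| < s / 2 := by
    have := hd.abs
    rw [abs_zero] at this
    exact this.eventually (gt_mem_nhds (half_pos hs))
  refine tendsto_of_tendsto_of_tendsto_of_le_of_le' tendsto_const_nhds (hD (s / 2) (half_pos hs))
    (Eventually.of_forall fun N => zero_le) ?_
  filter_upwards [hd'] with N hN
  refine measure_mono fun ξ hξ => ?_
  simp only [Set.mem_setOf_eq, sub_zero, Real.norm_eq_abs] at hξ ⊢
  by_contra hlt
  have := abs_add_le (D N ξ) (d N)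
  linarith [not_le.1 hlt]

end Increment

end Summit.Ventures.LatticeQCDFlow.Scoring.GlivenkoCantelli

end
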